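import Literature.Claims.NS.Lindgren2012
import Literature.Analysis.FluidPDE.NearBeltramiEnstrophyCriterion
import Literature.Analysis.FluidPDE.TaoEnstrophyLocalisationProofs
import Literature.Analysis.FluidPDE.AxisymNoSwirlTaoBounds
import Literature.Analysis.FluidPDE.LeiZhang2011Proofs
import Literature.Analysis.FluidPDE.LerayProfileCalculus
import Literature.Analysis.FluidPDE.EnergyUniqueness
import Literature.Analysis.FluidPDE.ConstantinFeffermanEnstrophySlab
import Mathlib.Analysis.Calculus.Deriv.MeanValue
import HarnessLib

/-!
# Solo salvage for claim C32 `Lindgren2012` (cell `ns-claims`, D-0090): the enstrophy identity (7)–(9)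
# and the parallel reduction (12) are TRUE in the rendered class — kernel discharges

Claim skeleton: `Literature/Claims/NS/Lindgren2012.lean` (typist `ns-claims-typist-9` g2; J. Lindgren,
arXiv:1207.1090 v3). Pre-registered locator: `Step4_VanishingIntegral` ((26), the vortex-stretching
integral asserted to vanish). This file (seat `ns-claims-salvage-p3`, a-priori-identity family) discharges
the two §1.1 preliminaries that precede it, in the rendered `H^∞ ∩ C^∞` class `Ruzmaikina2008.IsDatum`:

* `lindgren2012_step1_holds : Step1_EnstrophyIdentity` — (7) «∫ ω·(∇×u) dV = ∫ u·(∇×ω) dV»: the curl is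
  `L²`-self-adjoint on fields with `u, ∇u, ∇²u ∈ L²` (Majda–Bertozzi 2002 §1.7, Green's formula; tree
  `FarhatGrujic2018.integral_inner_curl_eq_integral_inner_curl_of_integrable`, the integrability of
  `ω × u`, `⟪u, ∇×ω⟫`, `|ω|²` supplied by the class through `integrable_norm_curl_sq`,
  `norm_fderiv_curl_le`).
* `lindgren2012_step2_holds : Step2_ParallelReduction` — (12) «E = ∫ u_∥·(∇×ω) dV»: pointwise
  `⟪u_∥, c⟫ = ⟪u, c⟫` for the orthogonal projection `u_∥ = (⟪u,c⟫/‖c‖²)c` onto `c = ∇×ω` (also on the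
  zero set of `c`, where both sides vanish), then Step 1.

* (rev 2) `lindgren2012_step5_holds : Step5_EnstrophyBound` — (27)–(28): if along a solution of the class the
  enstrophy has derivative `2ν∫⟪ω, Δω⟫` within `[0,T]`, then `E(t) ≤ E(0)`. The viscous pairing is
  non-positive in the class: `∫⟪ω, Δω⟫ = −∫|∇ω|²_F ≤ 0` (`dissip_nonpos`, from `Δ|ω|² = 2⟪Δω,ω⟫ + 2|∇ω|²`,
  tree `laplacian_inner_self_eq`, and `∫ div(∇|ω|²) = 0` for an integrable `C¹` field with integrable
  divergence, tree `PineauVicol2026.integral_divergence_eq_zero_of_integrable` — no decay assumption beyond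
  the `L²` bounds of the class), then Mathlib `antitoneOn_of_hasDerivWithinAt_nonpos`.

Solo lane (`Theorems/SoloSalvage<Slug>.lean`, no item).

WHAT THIS IS NOT: not a claim about NS regularity or blow-up; not a claim about any author beyond the
typed locator.
-/

noncomputable section

-- The summit-side namespace repeats the summit name by design (D-0017 layout); tree precedent
-- `SoloSalvageLam2019.lean`.
set_option linter.dupNamespace false

open MeasureTheory Set
open scoped ENNReal ContDiff RealInnerProductSpace

namespace Summit.NavierStokesRegularity.NavierStokesRegularity.Theorems.Lindgren2012Salvage

open Literature.Analysis.FluidPDE Literature.Claims.NS.Ruzmaikina2008 Literature.Claims.NS.Lindgren2012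

/-- In the class, `u`, `ω = ∇×u` and `∇×ω` are square integrable (orders `0, 1, 2` of the `H^∞`
hypothesis; `‖∇×v‖ ≤ κ‖Dv‖`, `‖D(∇×v)‖ ≤ κ‖D²v‖`). -/
theorem integrable_sq_norms {v : EuclideanSpace ℝ (Fin 3) → EuclideanSpace ℝ (Fin 3)} (hv : IsDatum v) :
    Integrable (fun x => ‖v x‖ ^ 2) ∧ Integrable (fun x => ‖curl v x‖ ^ 2) ∧
      Integrable (fun x => ‖ccurl v x‖ ^ 2) := by
  obtain ⟨hsmooth, -, hsob⟩ := hv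
  have h0 : Integrable (fun x => ‖v x‖ ^ 2) := by
    have h := integrable_sq_norm_of_lintegral_lt_top
      (hsmooth.continuous_iteratedFDeriv (m := 0) (by simp)) (hsob 0)
    refine h.congr (Filter.Eventually.of_forall fun x => ?_)
    simp only [norm_iteratedFDeriv_zero]
  have h1 : Integrable (fun x => ‖curl v x‖ ^ 2) :=
    (integrable_norm_curl_sq (hsmooth.of_le (by norm_cast)) (hsob 1)).1
  -- `‖∇×(∇×v)‖ ≤ κ ‖D(∇×v)‖ ≤ κ² ‖D²v‖`
  have hv2 : ContDiff ℝ 2 v := hsmooth.of_le (by norm_cast)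
  have hD2c : Continuous (iteratedFDeriv ℝ 2 v) := hsmooth.continuous_iteratedFDeriv (by norm_cast)
  have hD2 : Integrable fun x => ‖iteratedFDeriv ℝ 2 v x‖ ^ 2 :=
    integrable_sq_norm_of_lintegral_lt_top hD2c (hsob 2)
  have hcc : Continuous (ccurl v) := by
    have h := contDiff_curl (n := 1) (v := curl v)
      (by exact_mod_cast (contDiff_curl (n := 2) (by exact_mod_cast (hsmooth.of_le (by norm_cast) : ContDiff ℝ 3 v))))
    exact h.continuous
  have hpt : ∀ x, ‖ccurl v x‖ ^ 2 ≤ (‖curlCLM‖ ^ 2) ^ 2 * ‖iteratedFDeriv ℝ 2 v x‖ ^ 2 := by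
    intro x
    have h1' : ‖ccurl v x‖ ≤ ‖curlCLM‖ * ‖fderiv ℝ (curl v) x‖ := norm_curl_le (curl v) x
    have h2' : ‖fderiv ℝ (curl v) x‖ ≤ ‖curlCLM‖ * ‖iteratedFDeriv ℝ 2 v x‖ := norm_fderiv_curl_le hv2 x
    have h3 : ‖ccurl v x‖ ≤ ‖curlCLM‖ ^ 2 * ‖iteratedFDeriv ℝ 2 v x‖ := by
      calc ‖ccurl v x‖ ≤ ‖curlCLM‖ * (‖curlCLM‖ * ‖iteratedFDeriv ℝ 2 v x‖) :=
            h1'.trans (mul_le_mul_of_nonneg_left h2' (norm_nonneg curlCLM))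
        _ = ‖curlCLM‖ ^ 2 * ‖iteratedFDeriv ℝ 2 v x‖ := by ring
    calc ‖ccurl v x‖ ^ 2 ≤ (‖curlCLM‖ ^ 2 * ‖iteratedFDeriv ℝ 2 v x‖) ^ 2 :=
          pow_le_pow_left₀ (norm_nonneg _) h3 2
      _ = (‖curlCLM‖ ^ 2) ^ 2 * ‖iteratedFDeriv ℝ 2 v x‖ ^ 2 := by ring
  have h2 : Integrable (fun x => ‖ccurl v x‖ ^ 2) :=
    (hD2.const_mul _).mono' (hcc.norm.pow 2).aestronglyMeasurable
      (Filter.Eventually.of_forall fun x => by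
        rw [Real.norm_eq_abs, abs_of_nonneg (sq_nonneg _)]; exact hpt x)
  exact ⟨h0, h1, h2⟩

/-- **Step 1 — the enstrophy identity (7) holds in the class**: `∫ ⟪∇×u, ∇×u⟫ = ∫ ⟪u, ∇×(∇×u)⟫` for
every `u ∈ IsDatum` (the curl is self-adjoint on `L²`-integrable pairs; Majda–Bertozzi 2002 §1.7; tree
`FarhatGrujic2018.integral_inner_curl_eq_integral_inner_curl_of_integrable`). -/
theorem lindgren2012_step1_holds : Literature.Claims.NS.Lindgren2012.Step1_EnstrophyIdentity := by
  intro v hv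
  obtain ⟨h0, h1, h2⟩ := integrable_sq_norms hv
  have hsmooth : ContDiff ℝ ∞ v := hv.1
  have hv1 : ContDiff ℝ 1 v := hsmooth.of_le (by norm_cast)
  have hω1 : ContDiff ℝ 1 (curl v) :=
    contDiff_curl (n := 1) (by exact_mod_cast (hsmooth.of_le (by norm_cast) : ContDiff ℝ 2 v))
  have hvc : Continuous v := hv1.continuous
  have hωc : Continuous (curl v) := hω1.continuous
  have hcc : Continuous (ccurl v) := by
    have h := contDiff_curl (n := 1) (v := curl v)
      (by exact_mod_cast (contDiff_curl (n := 2) (by exact_mod_cast (hsmooth.of_le (by norm_cast) : ContDiff ℝ 3 v))))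
    exact h.continuous
  -- `ω × u ∈ L¹`
  have hX : Integrable fun y => cross (curl v y) (v y) := by
    refine Integrable.mono' ((h1.add h0).div_const 2)
      ((crossCLM.continuous₂.comp₂ hωc hvc).aestronglyMeasurable) (Filter.Eventually.of_forall fun y => ?_)
    calc ‖cross (curl v y) (v y)‖ ≤ ‖curl v y‖ * ‖v y‖ := norm_cross_le_norm_mul_norm _ _
      _ ≤ (‖curl v y‖ ^ 2 + ‖v y‖ ^ 2) / 2 := by nlinarith [sq_nonneg (‖curl v y‖ - ‖v y‖)]
  -- `⟪u, ∇×ω⟫ ∈ L¹`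
  have hI1 : Integrable fun y => ⟪v y, curl (curl v) y⟫ := by
    refine Integrable.mono' ((h0.add h2).div_const 2)
      ((hvc.inner hcc).aestronglyMeasurable) (Filter.Eventually.of_forall fun y => ?_)
    calc ‖⟪v y, curl (curl v) y⟫‖ ≤ ‖v y‖ * ‖ccurl v y‖ := norm_inner_le_norm _ _
      _ ≤ (‖v y‖ ^ 2 + ‖ccurl v y‖ ^ 2) / 2 := by nlinarith [sq_nonneg (‖v y‖ - ‖ccurl v y‖)]
  -- `⟪ω, ω⟫ ∈ L¹`
  have hI2 : Integrable fun y => ⟪curl v y, curl v y⟫ :=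
    h1.congr (Filter.Eventually.of_forall fun y => (real_inner_self_eq_norm_sq _).symm)
  exact FarhatGrujic2018.integral_inner_curl_eq_integral_inner_curl_of_integrable hv1 hω1 hX hI1 hI2

/-- Pointwise, the projection onto `c = ∇×ω` is invisible to the pairing with `c`:
`⟪u_∥(x), c(x)⟫ = ⟪u(x), c(x)⟫` (on the zero set of `c` both sides vanish). -/
theorem inner_uPar_ccurl (v : EuclideanSpace ℝ (Fin 3) → EuclideanSpace ℝ (Fin 3))
    (x : EuclideanSpace ℝ (Fin 3)) : ⟪uPar v x, ccurl v x⟫ = ⟪v x, ccurl v x⟫ := by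
  unfold uPar
  rw [real_inner_smul_left, real_inner_self_eq_norm_sq]
  by_cases hc : ‖ccurl v x‖ = 0
  · have hc' : ccurl v x = 0 := norm_eq_zero.1 hc
    simp [hc']
  · field_simp

/-- **Step 2 — the parallel reduction (12) holds in the class**: `E = ∫ |ω|² = ∫ ⟪u_∥, ∇×ω⟫` (pointwise
`⟪u_∥, ∇×ω⟫ = ⟪u, ∇×ω⟫`, then the enstrophy identity of Step 1). -/
theorem lindgren2012_step2_holds : Literature.Claims.NS.Lindgren2012.Step2_ParallelReduction := by
  intro v hv
  unfold enstrophy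
  have h1 := lindgren2012_step1_holds v hv
  simp_rw [inner_uPar_ccurl]
  rw [← integral_congr_ae (Filter.Eventually.of_forall fun x => real_inner_self_eq_norm_sq (curl v x))]
  exact h1

/-! ### rev 2: the viscous pairing is non-positive in the class; Step 5 -/

open scoped Laplacian

/-- **`∫ ⟪ω, Δω⟫ ≤ 0` in the class** (`ω = ∇×v`, `v ∈ IsDatum`): with `φ = |ω|²`,
`div (∇φ) = Δφ = 2⟪Δω, ω⟫ + 2|∇ω|²_F` (`laplacian_inner_self_eq`) and `∫ div(∇φ) = 0`, the gradient
`∇φ = 2⟪ω, Dω·⟫` and its divergence being integrable by the `L²` bounds on `ω, ∇ω, ∇²ω` of the class;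
hence `∫⟪ω, Δω⟫ = −∫|∇ω|²_F ≤ 0`. -/
theorem dissip_nonpos {v : EuclideanSpace ℝ (Fin 3) → EuclideanSpace ℝ (Fin 3)} (hv : IsDatum v) :
    dissip v ≤ 0 := by
  obtain ⟨h0, h1, h2⟩ := integrable_sq_norms hv
  obtain ⟨hsmooth, -, hsob⟩ := hv
  set w : EuclideanSpace ℝ (Fin 3) → EuclideanSpace ℝ (Fin 3) := curl v with hw
  have hw2 : ContDiff ℝ 2 w :=
    contDiff_curl (n := 2) (by exact_mod_cast (hsmooth.of_le (by norm_cast) : ContDiff ℝ 3 v))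
  have hw1 : ContDiff ℝ 1 w := hw2.of_le (by norm_cast)
  have hwc : Continuous w := hw1.continuous
  have hDwc : Continuous (fderiv ℝ w) := hw1.continuous_fderiv one_ne_zero
  -- `L²` bounds of the class for `ω`, `∇ω`, `Δω`
  have hv3 : ContDiff ℝ 3 v := hsmooth.of_le (by norm_cast)
  have hFrob : Integrable fun x => frobeniusNormSq (fderiv ℝ w x) :=
    (integrable_frobeniusNormSq_fderiv_curl hv3 (hsob 2)).1
  have hDw_sq : Integrable fun x => ‖fderiv ℝ w x‖ ^ 2 :=
    hFrob.mono' (hDwc.norm.pow 2).aestronglyMeasurable (Filter.Eventually.of_forall fun x => by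
      rw [Real.norm_eq_abs, abs_of_nonneg (sq_nonneg _)]; exact sq_opNorm_le_frobeniusNormSq _)
  have hD3c : Continuous (iteratedFDeriv ℝ 3 v) := hsmooth.continuous_iteratedFDeriv (by norm_cast)
  have hD3 : Integrable fun x => ‖iteratedFDeriv ℝ 3 v x‖ ^ 2 :=
    integrable_sq_norm_of_lintegral_lt_top hD3c (hsob 3)
  have hΔc : Continuous (Δ w) := continuous_laplacian hw2
  have hΔpt : ∀ x, ‖(Δ w) x‖ ≤ 3 * ‖curlCLM‖ * ‖iteratedFDeriv ℝ 3 v x‖ := by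
    intro x
    have e1 : ‖fderiv ℝ (fderiv ℝ w) x‖ = ‖iteratedFDeriv ℝ 2 w x‖ := by
      rw [← norm_iteratedFDeriv_one (𝕜 := ℝ) (fderiv ℝ w), norm_iteratedFDeriv_fderiv]
    have h3 : ‖iteratedFDeriv ℝ 2 w x‖ ≤ ‖curlCLM‖ * ‖iteratedFDeriv ℝ 3 v x‖ :=
      norm_iteratedFDeriv_curl_le_opNorm_mul (N := ⊤) hsmooth 2 le_top x
    calc ‖(Δ w) x‖ ≤ Module.finrank ℝ (EuclideanSpace ℝ (Fin 3)) * ‖fderiv ℝ (fderiv ℝ w) x‖ :=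
          norm_laplacian_le w x
      _ = 3 * ‖iteratedFDeriv ℝ 2 w x‖ := by rw [finrank_euclideanSpace_fin, e1]; norm_num
      _ ≤ 3 * (‖curlCLM‖ * ‖iteratedFDeriv ℝ 3 v x‖) := by gcongr
      _ = 3 * ‖curlCLM‖ * ‖iteratedFDeriv ℝ 3 v x‖ := by ring
  have hΔ_sq : Integrable fun x => ‖(Δ w) x‖ ^ 2 :=
    (hD3.const_mul ((3 * ‖curlCLM‖) ^ 2)).mono' (hΔc.norm.pow 2).aestronglyMeasurable
      (Filter.Eventually.of_forall fun x => by
        rw [Real.norm_eq_abs, abs_of_nonneg (sq_nonneg _)]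
        calc ‖(Δ w) x‖ ^ 2 ≤ (3 * ‖curlCLM‖ * ‖iteratedFDeriv ℝ 3 v x‖) ^ 2 :=
              pow_le_pow_left₀ (norm_nonneg _) (hΔpt x) 2
          _ = (3 * ‖curlCLM‖) ^ 2 * ‖iteratedFDeriv ℝ 3 v x‖ ^ 2 := by ring)
  -- the pairing `⟪Δω, ω⟫` is integrable
  have hpair : Integrable fun x => ⟪(Δ w) x, w x⟫ := by
    refine Integrable.mono' ((hΔ_sq.add h1).div_const 2) ((hΔc.inner hwc).aestronglyMeasurable)
      (Filter.Eventually.of_forall fun x => ?_)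
    have hab : ‖(Δ w) x‖ * ‖w x‖ ≤ (‖(Δ w) x‖ ^ 2 + ‖w x‖ ^ 2) / 2 := by
      nlinarith [sq_nonneg (‖(Δ w) x‖ - ‖w x‖)]
    exact (norm_inner_le_norm _ _).trans hab
  -- the field `F = ∇|ω|²` and its divergence
  set φ : EuclideanSpace ℝ (Fin 3) → ℝ := fun y => ⟪w y, w y⟫ with hφ
  have hφ2 : ContDiff ℝ 2 φ := (hw2.inner ℝ hw2)
  have hF1 : ContDiff ℝ 1 (gradient φ) :=
    (InnerProductSpace.toDual ℝ (EuclideanSpace ℝ (Fin 3))).symm.contDiff.comp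
      (hφ2.fderiv_right (m := 1) le_rfl)
  have hFnorm : ∀ x, ‖gradient φ x‖ ≤ 2 * (‖w x‖ * ‖fderiv ℝ w x‖) := by
    intro x
    have hdx : DifferentiableAt ℝ w x := (hw1.differentiable one_ne_zero) x
    have e : ‖gradient φ x‖ = ‖fderiv ℝ φ x‖ := by
      rw [gradient]; exact (InnerProductSpace.toDual ℝ _).symm.norm_map _
    rw [e]
    refine ContinuousLinearMap.opNorm_le_bound _ (by positivity) fun y => ?_
    rw [hφ, fderiv_inner_apply ℝ hdx hdx y]
    calc ‖⟪w x, fderiv ℝ w x y⟫ + ⟪fderiv ℝ w x y, w x⟫‖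
        ≤ ‖⟪w x, fderiv ℝ w x y⟫‖ + ‖⟪fderiv ℝ w x y, w x⟫‖ := norm_add_le _ _
      _ ≤ ‖w x‖ * ‖fderiv ℝ w x y‖ + ‖fderiv ℝ w x y‖ * ‖w x‖ :=
          add_le_add (norm_inner_le_norm _ _) (norm_inner_le_norm _ _)
      _ ≤ ‖w x‖ * (‖fderiv ℝ w x‖ * ‖y‖) + ‖fderiv ℝ w x‖ * ‖y‖ * ‖w x‖ := by
          gcongr <;> exact ContinuousLinearMap.le_opNorm _ _
      _ = 2 * (‖w x‖ * ‖fderiv ℝ w x‖) * ‖y‖ := by ring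
  have hFint : Integrable (gradient φ) := by
    refine Integrable.mono' ((h1.add hDw_sq)) hF1.continuous.aestronglyMeasurable
      (Filter.Eventually.of_forall fun x => ?_)
    have hab : 2 * (‖w x‖ * ‖fderiv ℝ w x‖) ≤ ‖w x‖ ^ 2 + ‖fderiv ℝ w x‖ ^ 2 := by
      nlinarith [sq_nonneg (‖w x‖ - ‖fderiv ℝ w x‖)]
    exact (hFnorm x).trans hab
  have hdiv_eq : ∀ x, VectorCalculus.divergence (gradient φ) x =
      2 * ⟪(Δ w) x, w x⟫ + 2 * frobeniusNormSq (fderiv ℝ w x) := fun x => by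
    rw [divergence_gradient hφ2 x, hφ, laplacian_inner_self_eq hw2 x]
  have hdiv_int : Integrable fun x => VectorCalculus.divergence (gradient φ) x := by
    have : (fun x => VectorCalculus.divergence (gradient φ) x) =
        fun x => 2 * ⟪(Δ w) x, w x⟫ + 2 * frobeniusNormSq (fderiv ℝ w x) := funext hdiv_eq
    rw [this]
    exact (hpair.const_mul 2).add (hFrob.const_mul 2)
  have h0int := PineauVicol2026.integral_divergence_eq_zero_of_integrable hF1 hFint hdiv_int
  simp_rw [hdiv_eq] at h0int
  rw [integral_add (hpair.const_mul 2) (hFrob.const_mul 2), integral_const_mul, integral_const_mul]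
    at h0int
  -- `∫⟪ω, Δω⟫ = ∫⟪Δω, ω⟫ = −∫|∇ω|² ≤ 0`
  have hsymm : dissip v = ∫ x, ⟪(Δ w) x, w x⟫ := by
    unfold dissip
    exact integral_congr_ae (Filter.Eventually.of_forall fun x => real_inner_comm _ _)
  have hFrob0 : 0 ≤ ∫ x, frobeniusNormSq (fderiv ℝ w x) :=
    integral_nonneg fun x => frobeniusNormSq_nonneg _
  rw [hsymm]
  linarith

/-- **Step 5 — (27)–(28) + «if the total enstrophy stays bounded» holds in the class**: along a solution
on `[0,T]` whose enstrophy has derivative `2ν∫⟪ω, Δω⟫` within `[0,T]` at every time, `E(t) ≤ E(0)` on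
`[0,T]` (the derivative is `≤ 0` by `dissip_nonpos` and `ν > 0`; a function with non-positive derivative
on an interval does not increase, Mathlib `antitoneOn_of_hasDerivWithinAt_nonpos`). -/
theorem lindgren2012_step5_holds : Literature.Claims.NS.Lindgren2012.Step5_EnstrophyBound := by
  intro ν T u p hν hT hsol hderiv t ht
  have hcont : ContinuousOn (fun s => enstrophy (u s)) (Icc 0 T) :=
    fun s hs => (hderiv s hs).continuousWithinAt
  have hanti : AntitoneOn (fun s => enstrophy (u s)) (Icc 0 T) := by
    refine antitoneOn_of_hasDerivWithinAt_nonpos (convex_Icc 0 T) hcont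
      (f' := fun s => 2 * (ν * dissip (u s))) (fun s hs => ?_) (fun s hs => ?_)
    · rw [interior_Icc] at hs ⊢
      exact (hderiv s (Ioo_subset_Icc_self hs)).mono Ioo_subset_Icc_self
    · rw [interior_Icc] at hs
      have hd : dissip (u s) ≤ 0 := dissip_nonpos (isDatum_slice hsol (Ioo_subset_Icc_self hs))
      nlinarith
  exact hanti ⟨le_rfl, hT.le⟩ ht ht.1

end Summit.NavierStokesRegularity.NavierStokesRegularity.Theorems.Lindgren2012Salvage

end
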